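import Summits.CriticalPhenomena.PercolationContinuityZ3.Theorems.PercAnnulusCrossingIICRecurrenceZeroOne
import Summits.CriticalPhenomena.PercolationContinuityZ3.Theorems.PercAnnulusCrossingIICVolumeGrowth
import HarnessLib

/-!
# The volume growth rates of Kesten's IIC are deterministic: `limsup / liminf |C(0) ∩ Λ(n)| / (|Λ(n)|π_{p_c}(n))` are a.s. constant (lane RSW3, p1 gen 14)

builds on p205010 (kernel theorem, internal audit signed; external expert review pending) — used through `θ(p_c) = 0`
(`CSH.percolationContinuity_allDimensions`, gen 10's tail triviality, p2's volume laws); the `ℤ²` statement is unconditional.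

Seat `prim-rsw3-p1` (gen 14); memo `run/shared/lean/prim/rsw3/P1-QM.md` §27.  Helper file for the crux `stmt-CriticalPhenomena-4575`
chain; no definitions, no sorries.  `V_n = #{z ∈ Λ(n) : 0 ↔ z}`, `s(n) = (2n+1)^d π_{p_c}(n)`.

The functionals `L⁺ = limsup_n V_n/s(n)` and `L⁻ = liminf_n V_n/s(n)` (valued in `[0, ∞]`) are NOT tail measurable, but for every `K` they
coincide `ν`-a.s. with the same functionals of the FAR volume `#{z ∈ Λ(n) : z percolates in ω ∖ E⁺(Λ(K))}`, which is determined off `Λ(K)`: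
the difference is at most the (finite, gen 14 `finite_bush`) bush of `Λ(K)`, and `s(n) → ∞`.  Under tail triviality (gen 10):

* **`exists_ae_eq_const_of_forall_real_setOf_le`** (abstract) — an `[0,∞]`-valued measurable function all of whose sub-level sets have
  probability `0` or `1` is a.s. constant;
* **`real_setOf_le_eq_zero_or_one_of_isTailTrivial`** — under a tail-trivial measure, a function that is a.s. equal, for every `K`, to a
  function with sub-level sets determined off `Λ(K).sym2` has trivial sub-level sets (gen 14 `real_eq_zero_or_one_of_isTailTrivial_of_approx`);
* `limsup_ofReal_div_eq_of_sub_le`, `liminf_ofReal_div_eq_of_sub_le` — `limsup/liminf` of `a_n/s_n` and `b_n/s_n` agree when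
  `b_n ≤ a_n ≤ b_n + B` and `s_n → ∞`;
* **`iicMeasure_exists_ae_limsup_volume_eq_const`**, **`iicMeasure_exists_ae_liminf_volume_eq_const`** — at `p_c(ℤ^d)` under (A2)□ at aspect
  `(s,L)` (`2 ≤ s ≤ L`): for every IIC probability measure there are constants `c⁺, c⁻ ∈ [0,∞]` with `limsup_n V_n/s(n) = c⁺` and
  `liminf_n V_n/s(n) = c⁻` almost surely — **the upper and lower volume growth rates of Kesten's IIC are deterministic**; under tightness of
  the annulus crossing-cluster count at one aspect `c⁺ ≥ λ > 0` (`iicMeasure_exists_ae_limsup_volume_eq_const_pos`, from gen 14's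
  `iicMeasure_ae_frequently_le_volume`); `_Z2` unconditional.

References: H.-O. Georgii, *Gibbs Measures and Phase Transitions* (2011), Prop. 7.9, Thm. 7.7; H. Kesten, PTRF 73 (1986) Thm. (8);
D. Basu, A. Sapozhnikov, ECP 22 (2017) no. 26.
-/

noncomputable section

namespace Summit.CriticalPhenomena.PercolationContinuityZ3.Theorems.Crossing

open MeasureTheory Filter Topology Literature.Probability.Percolation Literature.Probability.LatticeModels
open Literature.Probability.Percolation.DCT16 Literature.Probability.Percolation.DKT20
open Summit.CriticalPhenomena.PercolationContinuityZ3.Theorems.SurfaceTension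
open scoped Literature.Probability.Percolation ENNReal symmDiff

variable {d : ℕ}

/-! ## Abstract: trivial sub-level sets force an a.s. constant -/

/-- **A `[0,∞]`-valued measurable function all of whose sub-level sets have probability `0` or `1` is a.s. constant**: the constant is
`c = inf {q | μ(f ≤ q) = 1}` — `μ(f ≤ c) = 1` along a sequence `q_n ↓ c` in that set, and `μ(f < c) = 0` as a countable union over a dense
countable set of levels `q < c`, each with `μ(f ≤ q) = 0`. [folklore] -/
theorem exists_ae_eq_const_of_forall_real_setOf_le {Ω : Type*} [MeasurableSpace Ω] (μ : Measure Ω) [IsProbabilityMeasure μ]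
    {f : Ω → ℝ≥0∞} (hf : Measurable f) (h : ∀ q : ℝ≥0∞, μ.real {ω | f ω ≤ q} = 0 ∨ μ.real {ω | f ω ≤ q} = 1) :
    ∃ c : ℝ≥0∞, ∀ᵐ ω ∂μ, f ω = c := by
  set Q : Set ℝ≥0∞ := {q | μ.real {ω | f ω ≤ q} = 1} with hQ
  have htop : (⊤ : ℝ≥0∞) ∈ Q := by
    simp only [hQ, Set.mem_setOf_eq, le_top, Set.setOf_true, probReal_univ]
  have hQne : Q.Nonempty := ⟨⊤, htop⟩
  set c : ℝ≥0∞ := sInf Q with hc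
  refine ⟨c, ?_⟩
  -- (1) `f ≤ c` a.s.
  obtain ⟨u, -, hu, huQ⟩ := exists_seq_tendsto_sInf hQne (OrderBot.bddBelow Q)
  have hle : ∀ᵐ ω ∂μ, ∀ n, f ω ≤ u n := by
    rw [ae_all_iff]
    intro n
    have h1 : μ.real {ω | f ω ≤ u n} = 1 := huQ n
    have hm : MeasurableSet {ω | f ω ≤ u n} := measurableSet_le hf measurable_const
    have : μ {ω | f ω ≤ u n}ᶜ = 0 := by
      rw [measure_compl hm (measure_ne_top μ _), measure_univ, ← ofReal_measureReal (measure_ne_top μ _), h1, ENNReal.ofReal_one]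
      exact tsub_self 1
    exact measure_mono_null (fun ω (hω : ¬ f ω ≤ u n) hω' => hω hω') this
  -- (2) `f < c` is null: countable union over a dense countable set of levels below `c`
  obtain ⟨D, hDc, hDd⟩ := TopologicalSpace.exists_countable_dense ℝ≥0∞
  have hnull : ∀ q, q < c → μ {ω | f ω ≤ q} = 0 := by
    intro q hq
    rcases h q with h0 | h1
    · exact (measureReal_eq_zero_iff (measure_ne_top μ _)).1 h0
    · exact absurd (csInf_le (OrderBot.bddBelow Q) h1) (not_le.2 (hc ▸ hq))
  have hlt : μ {ω | f ω < c} = 0 := by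
    have hsub : {ω | f ω < c} ⊆ ⋃ q ∈ {q ∈ D | q < c}, {ω | f ω ≤ q} := by
      intro ω hω
      obtain ⟨q, hqD, hq1, hq2⟩ : ∃ q ∈ D, f ω < q ∧ q < c := by
        obtain ⟨q, hqD, hq⟩ := hDd.exists_mem_open isOpen_Ioo (Set.nonempty_Ioo.2 hω)
        exact ⟨q, hqD, hq.1, hq.2⟩
      exact Set.mem_iUnion₂.2 ⟨q, ⟨hqD, hq2⟩, hq1.le⟩
    refine measure_mono_null hsub ((measure_biUnion_null_iff (hDc.mono (Set.sep_subset _ _))).2 fun q hq => hnull q hq.2)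
  filter_upwards [hle, measure_eq_zero_iff_ae_notMem.1 hlt] with ω hω hω'
  have h1 : f ω ≤ c := ge_of_tendsto' hu hω
  have h2 : ¬ f ω < c := hω'
  exact le_antisymm h1 (not_lt.1 h2)

/-- **Almost-far-measurable functions have trivial sub-level sets under a tail-trivial measure**: if `ν` is tail trivial and the measurable
`f` is, for every `K`, `ν`-a.s. equal to a measurable `g` whose sub-level sets are determined by the pairs off `Λ(K).sym2`, then
`ν(f ≤ q) ∈ {0,1}` for every `q`. [cite: Georgii2011, Prop. 7.9] -/
theorem real_setOf_le_eq_zero_or_one_of_isTailTrivial {ν : Measure (BondConfig (Site d))} [IsProbabilityMeasure ν]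
    (hT : IsTailTrivial (V := Sym2 (Site d)) (S := Prop) ν) {f : BondConfig (Site d) → ℝ≥0∞} (hf : Measurable f)
    (happrox : ∀ K : ℕ, ∃ g : BondConfig (Site d) → ℝ≥0∞, Measurable g ∧
      (∀ q : ℝ≥0∞, DeterminedBy {ω | g ω ≤ q} {e : Sym2 (Site d) | e ∉ (↑((box d K).sym2) : Set (Sym2 (Site d)))}) ∧ f =ᵐ[ν] g)
    (q : ℝ≥0∞) : ν.real {ω | f ω ≤ q} = 0 ∨ ν.real {ω | f ω ≤ q} = 1 := by
  refine real_eq_zero_or_one_of_isTailTrivial_of_approx hT (measurableSet_le hf measurable_const) fun K δ hδ => ?_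
  obtain ⟨g, hg, hgd, hfg⟩ := happrox K
  refine ⟨{ω | g ω ≤ q}, measurableSet_le hg measurable_const, hgd q, ?_⟩
  have h0 : ν ({ω | f ω ≤ q} ∆ {ω | g ω ≤ q}) = 0 := by
    refine measure_symmDiff_eq_zero_iff.2 (Filter.eventuallyEq_set.2 (hfg.mono fun ω hω => ?_))
    simp only [Set.mem_setOf_eq, hω]
  rw [measureReal_def, h0, ENNReal.toReal_zero]
  exact hδ.le

/-- **Hence almost-far-measurable functions are a.s. constant under a tail-trivial measure.** [cite: Georgii2011, Prop. 7.9] -/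
theorem exists_ae_eq_const_of_isTailTrivial {ν : Measure (BondConfig (Site d))} [IsProbabilityMeasure ν]
    (hT : IsTailTrivial (V := Sym2 (Site d)) (S := Prop) ν) {f : BondConfig (Site d) → ℝ≥0∞} (hf : Measurable f)
    (happrox : ∀ K : ℕ, ∃ g : BondConfig (Site d) → ℝ≥0∞, Measurable g ∧
      (∀ q : ℝ≥0∞, DeterminedBy {ω | g ω ≤ q} {e : Sym2 (Site d) | e ∉ (↑((box d K).sym2) : Set (Sym2 (Site d)))}) ∧ f =ᵐ[ν] g) :
    ∃ c : ℝ≥0∞, ∀ᵐ ω ∂ν, f ω = c :=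
  exists_ae_eq_const_of_forall_real_setOf_le ν hf (real_setOf_le_eq_zero_or_one_of_isTailTrivial hT hf happrox)

/-! ## `limsup / liminf` are insensitive to a bounded perturbation of the numerator when the denominator diverges -/

/-- If `b_n ≤ a_n ≤ b_n + B` (reals, `b_n ≥ 0`) and `s_n → ∞` with `s_n > 0`, then `limsup a_n/s_n = limsup b_n/s_n` in `[0,∞]`. [folklore] -/
theorem limsup_ofReal_div_eq_of_sub_le {a b s : ℕ → ℝ} {B : ℝ} (hb : ∀ n, 0 ≤ b n) (hab : ∀ n, b n ≤ a n) (haB : ∀ n, a n ≤ b n + B)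
    (hs : ∀ n, 0 < s n) (hlim : Tendsto s atTop atTop) :
    limsup (fun n => ENNReal.ofReal (a n / s n)) atTop = limsup (fun n => ENNReal.ofReal (b n / s n)) atTop := by
  have hB : 0 ≤ B := by linarith [hab 0, haB 0]
  refine le_antisymm ?_ ?_
  · -- for every `ε > 0`, eventually `a_n/s_n ≤ b_n/s_n + ε`
    refine ENNReal.le_of_forall_pos_le_add fun ε hε _ => ?_
    have hε' : (0 : ℝ) < ε := NNReal.coe_pos.2 hε
    have hev : ∀ᶠ n in atTop, B / s n ≤ ε := (hlim.const_div_atTop B).eventually (ge_mem_nhds hε')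
    calc limsup (fun n => ENNReal.ofReal (a n / s n)) atTop
        ≤ limsup (fun n => ENNReal.ofReal (b n / s n) + (ε : ℝ≥0∞)) atTop := by
          refine limsup_le_limsup (hev.mono fun n hn => ?_)
          calc ENNReal.ofReal (a n / s n) ≤ ENNReal.ofReal (b n / s n + B / s n) := by
                rw [← add_div]; exact ENNReal.ofReal_le_ofReal (div_le_div_of_nonneg_right (haB n) (hs n).le)
            _ = ENNReal.ofReal (b n / s n) + ENNReal.ofReal (B / s n) :=
                ENNReal.ofReal_add (div_nonneg (hb n) (hs n).le) (div_nonneg hB (hs n).le)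
            _ ≤ ENNReal.ofReal (b n / s n) + (ε : ℝ≥0∞) := by
                refine add_le_add le_rfl ?_
                rw [← ENNReal.ofReal_coe_nnreal]
                exact ENNReal.ofReal_le_ofReal hn
      _ = limsup (fun n => ENNReal.ofReal (b n / s n)) atTop + (ε : ℝ≥0∞) :=
          limsup_add_const atTop _ _ (by isBoundedDefault) (by isBoundedDefault)
  · exact limsup_le_limsup (Filter.Eventually.of_forall fun n =>
      ENNReal.ofReal_le_ofReal (div_le_div_of_nonneg_right (hab n) (hs n).le))

/-- If `b_n ≤ a_n ≤ b_n + B` (reals, `b_n ≥ 0`) and `s_n → ∞` with `s_n > 0`, then `liminf a_n/s_n = liminf b_n/s_n` in `[0,∞]`. [folklore] -/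
theorem liminf_ofReal_div_eq_of_sub_le {a b s : ℕ → ℝ} {B : ℝ} (hb : ∀ n, 0 ≤ b n) (hab : ∀ n, b n ≤ a n) (haB : ∀ n, a n ≤ b n + B)
    (hs : ∀ n, 0 < s n) (hlim : Tendsto s atTop atTop) :
    liminf (fun n => ENNReal.ofReal (a n / s n)) atTop = liminf (fun n => ENNReal.ofReal (b n / s n)) atTop := by
  have hB : 0 ≤ B := by linarith [hab 0, haB 0]
  refine le_antisymm ?_ ?_
  · -- for every `ε > 0`, eventually `a_n/s_n ≤ b_n/s_n + ε`
    refine ENNReal.le_of_forall_pos_le_add fun ε hε _ => ?_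
    have hε' : (0 : ℝ) < ε := NNReal.coe_pos.2 hε
    have hev : ∀ᶠ n in atTop, B / s n ≤ ε := (hlim.const_div_atTop B).eventually (ge_mem_nhds hε')
    calc liminf (fun n => ENNReal.ofReal (a n / s n)) atTop
        ≤ liminf (fun n => ENNReal.ofReal (b n / s n) + (ε : ℝ≥0∞)) atTop := by
          refine liminf_le_liminf (hev.mono fun n hn => ?_)
          calc ENNReal.ofReal (a n / s n) ≤ ENNReal.ofReal (b n / s n + B / s n) := by
                rw [← add_div]; exact ENNReal.ofReal_le_ofReal (div_le_div_of_nonneg_right (haB n) (hs n).le)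
            _ = ENNReal.ofReal (b n / s n) + ENNReal.ofReal (B / s n) :=
                ENNReal.ofReal_add (div_nonneg (hb n) (hs n).le) (div_nonneg hB (hs n).le)
            _ ≤ ENNReal.ofReal (b n / s n) + (ε : ℝ≥0∞) := by
                refine add_le_add le_rfl ?_
                rw [← ENNReal.ofReal_coe_nnreal]
                exact ENNReal.ofReal_le_ofReal hn
      _ = liminf (fun n => ENNReal.ofReal (b n / s n)) atTop + (ε : ℝ≥0∞) :=
          liminf_add_const atTop _ _ (by isBoundedDefault) (by isBoundedDefault)
  · exact liminf_le_liminf (Filter.Eventually.of_forall fun n =>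
      ENNReal.ofReal_le_ofReal (div_le_div_of_nonneg_right (hab n) (hs n).le))

/-! ## The volume growth rates of the IIC, under any normalisation, are deterministic -/

open Classical in
/-- The IIC volume `ω ↦ #{z ∈ Λ(n) : ω ∈ A_z}` is a measurable real function for measurable `A_z`. [folklore] -/
theorem measurable_card_filter_box (n : ℕ) {A : Site d → Set (BondConfig (Site d))} (hA : ∀ z, MeasurableSet (A z)) :
    Measurable fun ω : BondConfig (Site d) => ((((box d n).filter fun z => ω ∈ A z).card : ℕ) : ℝ) := by
  have h : (fun ω : BondConfig (Site d) => ((((box d n).filter fun z => ω ∈ A z).card : ℕ) : ℝ)) =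
      fun ω => ∑ z ∈ box d n, (A z).indicator 1 ω := funext fun ω => Rsw3.card_filter_mem_eq_sum_indicator (box d n) A ω
  rw [h]
  exact Finset.measurable_sum _ fun z _ => measurable_one.indicator (hA z)

open Classical in
/-- **THE VOLUME GROWTH RATES OF KESTEN'S IIC ARE DETERMINISTIC** (`θ(p) = 0`, (A2)□ at aspect `(s,L)` with `2 ≤ s`, `0 < p`, `d ≥ 1`; `ν` any IIC
probability measure; `σ_n > 0` ANY normalisation with `σ_n → ∞`): there are constants `c⁺, c⁻ ∈ [0, ∞]` with
`limsup_n #{z ∈ Λ(n) : 0 ↔ z}/σ_n = c⁺` and `liminf_n #{z ∈ Λ(n) : 0 ↔ z}/σ_n = c⁻` `ν`-almost surely.  Proof: for every `K` both functionals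
coincide a.s. with those of the far volume `#{z ∈ Λ(n) : z percolates in ω ∖ E⁺(Λ(K))}` (the difference is at most the finite bush of `Λ(K)`,
`finite_bush`; far-percolating sites are joined to `0` a.s.), whose sub-level sets are determined off `Λ(K).sym2`; tail triviality (gen 10).
[cite: Georgii2011, Prop. 7.9] [cite: Kesten1986, Thm. (8)] [cite: BasuSapozhnikov2017ECP, Thm. 1.1] -/
theorem iicMeasure_exists_ae_limsup_liminf_volume_eq_const (hd : 1 ≤ d) (p : unitInterval) (hp : 0 < (p : ℝ))
    (hθ : theta (zdGraph d) 0 p = 0) {s L : ℕ} (hs : 2 ≤ s) {ϰ : ℝ} (hϰ : 0 < ϰ) (hA2 : SetToSetQuasiMultAspectAt d p s L ϰ)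
    {ν : Measure (BondConfig (Site d))} [IsProbabilityMeasure ν]
    (hν : ∀ (F : Finset (Sym2 (Site d))) (E : Set (BondConfig (Site d))), MeasurableSet E → DeterminedBy E ↑F →
      Tendsto (fun n : ℕ => (bondPercolation (zdGraph d) p).real (E ∩ siteToBoundary d n) / oneArmProb d p n)
        atTop (𝓝 (ν.real E)))
    (σ : ℕ → ℝ) (hσ : ∀ n, 0 < σ n) (hσlim : Tendsto σ atTop atTop) :
    (∃ c : ℝ≥0∞, ∀ᵐ ω ∂ν, limsup (fun n => ENNReal.ofReal
        (((((box d n).filter fun z => ω ∈ (openConn (0 : Site d) z : Set (BondConfig (Site d)))).card : ℕ) : ℝ) / σ n)) atTop = c) ∧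
    (∃ c : ℝ≥0∞, ∀ᵐ ω ∂ν, liminf (fun n => ENNReal.ofReal
        (((((box d n).filter fun z => ω ∈ (openConn (0 : Site d) z : Set (BondConfig (Site d)))).card : ℕ) : ℝ) / σ n)) atTop = c) := by
  have hT := iicMeasure_isTailTrivial_of_setToSetQuasiMultAspectAt hd p hp hθ hs hϰ hA2 hν
  have hae := iicMeasure_ae_openConn_of_percolatesAt_sdiff hd p hp hθ (by omega : 1 ≤ s) hϰ hA2 hν
  have hlat := iicMeasure_ae_subset_edgeSet p hν
  set V : ℕ → BondConfig (Site d) → ℕ := fun n ω =>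
    ((box d n).filter fun z => ω ∈ (openConn (0 : Site d) z : Set (BondConfig (Site d)))).card with hV
  have hVm : ∀ n, Measurable fun ω => ((V n ω : ℕ) : ℝ) := fun n =>
    measurable_card_filter_box n fun z => measurableSet_openConn_holds (0 : Site d) z
  have hVq : ∀ n, Measurable fun ω => ENNReal.ofReal (((V n ω : ℕ) : ℝ) / σ n) := fun n =>
    ENNReal.measurable_ofReal.comp ((hVm n).div_const _)
  -- the far volumes at level `K` and the comparison with `V`
  have hfar : ∀ K : ℕ, ∃ W : ℕ → BondConfig (Site d) → ℕ,
      (∀ n, Measurable fun ω => ENNReal.ofReal (((W n ω : ℕ) : ℝ) / σ n)) ∧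
      (∀ (n : ℕ) (ω ω' : BondConfig (Site d)), ω ∩ {e : Sym2 (Site d) | e ∉ (↑((box d K).sym2) : Set (Sym2 (Site d)))} =
        ω' ∩ {e : Sym2 (Site d) | e ∉ (↑((box d K).sym2) : Set (Sym2 (Site d)))} → W n ω = W n ω') ∧
      ∀ᵐ ω ∂ν, ∃ B : ℝ, ∀ n, (W n ω : ℝ) ≤ V n ω ∧ (V n ω : ℝ) ≤ W n ω + B := by
    intro K
    set T : Set (Sym2 (Site d)) := {e : Sym2 (Site d) | ∃ w ∈ box d K, w ∈ e} with hTdef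
    set W : ℕ → BondConfig (Site d) → ℕ := fun n ω =>
      ((box d n).filter fun z => ω \ T ∈ (percolatesAt z : Set (BondConfig (Site d)))).card with hW
    refine ⟨W, fun n => ENNReal.measurable_ofReal.comp ((measurable_card_filter_box n fun z =>
      measurable_sdiff_touching T (measurableSet_percolatesAt_holds z)).div_const _), fun n ω ω' h => ?_, ?_⟩
    · have hT' : ω \ T = ω' \ T := sdiff_touching_eq_of_inter_eq h
      simp only [hW, hT']
    · filter_upwards [hae, hlat] with ω hω hωlat
      have hfin := finite_bush K hωlat
      refine ⟨(hfin.toFinset.card : ℝ), fun n => ⟨?_, ?_⟩⟩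
      · have : W n ω ≤ V n ω := by
          refine Finset.card_le_card fun z hz => ?_
          rw [Finset.mem_filter] at hz ⊢
          exact ⟨hz.1, hω T z hz.2⟩
        exact_mod_cast this
      · have hsplit := Finset.card_filter_add_card_filter_not
          (s := (box d n).filter fun z => ω ∈ (openConn (0 : Site d) z : Set (BondConfig (Site d))))
          (fun z => ω \ T ∈ (percolatesAt z : Set (BondConfig (Site d))))
        have h1 : (((box d n).filter fun z => ω ∈ (openConn (0 : Site d) z : Set (BondConfig (Site d)))).filter
            fun z => ω \ T ∈ (percolatesAt z : Set (BondConfig (Site d)))).card ≤ W n ω := by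
          refine Finset.card_le_card fun z hz => ?_
          simp only [Finset.mem_filter] at hz ⊢
          exact ⟨hz.1.1, hz.2⟩
        have h2 : (((box d n).filter fun z => ω ∈ (openConn (0 : Site d) z : Set (BondConfig (Site d)))).filter
            fun z => ¬ ω \ T ∈ (percolatesAt z : Set (BondConfig (Site d)))).card ≤ hfin.toFinset.card := by
          refine Finset.card_le_card fun z hz => ?_
          simp only [Finset.mem_filter] at hz
          exact hfin.mem_toFinset.2 ⟨hz.1.2, hz.2⟩
        have : V n ω ≤ W n ω + hfin.toFinset.card := by
          simp only [hV]; rw [← hsplit]; exact Nat.add_le_add h1 h2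
        exact_mod_cast this
  constructor
  · refine exists_ae_eq_const_of_isTailTrivial hT (Measurable.limsup hVq) fun K => ?_
    obtain ⟨W, hWm, hWd, hWV⟩ := hfar K
    refine ⟨fun ω => limsup (fun n => ENNReal.ofReal (((W n ω : ℕ) : ℝ) / σ n)) atTop, Measurable.limsup hWm, fun q => ?_, ?_⟩
    · rw [determinedBy_iff]
      intro ω ω' h
      simp only [Set.mem_setOf_eq, fun n => hWd n ω ω' h]
    · filter_upwards [hWV] with ω ⟨B, hB⟩
      exact limsup_ofReal_div_eq_of_sub_le (fun n => Nat.cast_nonneg _) (fun n => (hB n).1) (fun n => (hB n).2) hσ hσlim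
  · refine exists_ae_eq_const_of_isTailTrivial hT (Measurable.liminf hVq) fun K => ?_
    obtain ⟨W, hWm, hWd, hWV⟩ := hfar K
    refine ⟨fun ω => liminf (fun n => ENNReal.ofReal (((W n ω : ℕ) : ℝ) / σ n)) atTop, Measurable.liminf hWm, fun q => ?_, ?_⟩
    · rw [determinedBy_iff]
      intro ω ω' h
      simp only [Set.mem_setOf_eq, fun n => hWd n ω ω' h]
    · filter_upwards [hWV] with ω ⟨B, hB⟩
      exact liminf_ofReal_div_eq_of_sub_le (fun n => Nat.cast_nonneg _) (fun n => (hB n).1) (fun n => (hB n).2) hσ hσlim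

open Classical in
/-- **At `p_c(ℤ^d)` (`d ≥ 2`, (A2)□ at aspect `(s,L)`, `2 ≤ s`): `limsup_n` and `liminf_n` of `#{z ∈ Λ(n) : 0 ↔ z}/((2n+1)^d π_{p_c}(n))` are
`ν`-a.s. constant, for every IIC probability measure `ν`.** [cite: Kesten1986, Thm. (8)] [cite: BasuSapozhnikov2017ECP, Thm. 1.1]
[cite: Georgii2011, Prop. 7.9] -/
theorem iicMeasure_exists_ae_volume_rates_eq_const_criticalProbI (hd : 2 ≤ d) {s L : ℕ} (hs : 2 ≤ s) {ϰ : ℝ} (hϰ : 0 < ϰ)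
    (hA2 : SetToSetQuasiMultAspectAt d (criticalProbI d) s L ϰ)
    {ν : Measure (BondConfig (Site d))} [IsProbabilityMeasure ν]
    (hν : ∀ (F : Finset (Sym2 (Site d))) (E : Set (BondConfig (Site d))), MeasurableSet E → DeterminedBy E ↑F →
      Tendsto (fun n : ℕ => (bondPercolation (zdGraph d) (criticalProbI d)).real (E ∩ siteToBoundary d n) /
        oneArmProb d (criticalProbI d) n) atTop (𝓝 (ν.real E))) :
    (∃ c : ℝ≥0∞, ∀ᵐ ω ∂ν, limsup (fun n => ENNReal.ofReal
        (((((box d n).filter fun z => ω ∈ (openConn (0 : Site d) z : Set (BondConfig (Site d)))).card : ℕ) : ℝ) /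
          ((2 * (n : ℝ) + 1) ^ d * oneArmProb d (criticalProbI d) n))) atTop = c) ∧
    (∃ c : ℝ≥0∞, ∀ᵐ ω ∂ν, liminf (fun n => ENNReal.ofReal
        (((((box d n).filter fun z => ω ∈ (openConn (0 : Site d) z : Set (BondConfig (Site d)))).card : ℕ) : ℝ) /
          ((2 * (n : ℝ) + 1) ^ d * oneArmProb d (criticalProbI d) n))) atTop = c) := by
  have hd1 : 1 ≤ d := by omega
  have hpc : 0 < ((criticalProbI d : unitInterval) : ℝ) := by rw [coe_criticalProbI]; exact criticalProb_zd_pos d hd1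
  have hθ : theta (zdGraph d) 0 (criticalProbI d) = 0 := CSH.percolationContinuity_allDimensions d hd
  have hπpos : ∀ n, 0 < oneArmProb d (criticalProbI d) n := fun n =>
    (pow_pos hpc _).trans_le (DKT20.pow_le_real_siteToBoundary hd1 (criticalProbI d) _)
  exact iicMeasure_exists_ae_limsup_liminf_volume_eq_const hd1 (criticalProbI d) hpc hθ hs hϰ hA2 hν _
    (fun n => mul_pos (by positivity) (hπpos n)) (tendsto_card_box_mul_oneArmProb_atTop hd)

open Classical in
/-- **Under (A2)□ + tightness of the annulus crossing-cluster count at one aspect, the deterministic upper growth rate is positive**: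
`limsup_n #{z ∈ Λ(n) : 0 ↔ z}/((2n+1)^dπ_{p_c}(n)) = c⁺` a.s. with `c⁺ ≥ λ > 0` (`p_c(ℤ^d)`, `d ≥ 2`, (A2)□ at aspect `(s,L)`, `2 ≤ s ≤ L`; gen 14
`iicMeasure_ae_frequently_le_volume`). [cite: Kesten1986, Thm. (8)] [cite: BasuSapozhnikov2017ECP, Thm. 1.1] -/
theorem iicMeasure_exists_ae_limsup_volume_eq_const_pos (hd : 2 ≤ d) {s L : ℕ} (hs : 2 ≤ s) (hsL : s ≤ L) {ϰ : ℝ} (hϰ : 0 < ϰ)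
    (hA2 : SetToSetQuasiMultAspectAt d (criticalProbI d) s L ϰ) {C₀ : ℕ} (hC₀ : 2 ≤ C₀)
    (hTight : ∀ ε : ℝ, 0 < ε → ∃ k : ℕ, ∀ n : ℕ, 1 ≤ n →
      (bondPercolation (zdGraph d) (criticalProbI d)).real {ω | (k : ℕ∞) < annulusClusterCount d n (C₀ * n) ω} ≤ ε)
    {ν : Measure (BondConfig (Site d))} [IsProbabilityMeasure ν]
    (hν : ∀ (F : Finset (Sym2 (Site d))) (E : Set (BondConfig (Site d))), MeasurableSet E → DeterminedBy E ↑F →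
      Tendsto (fun n : ℕ => (bondPercolation (zdGraph d) (criticalProbI d)).real (E ∩ siteToBoundary d n) /
        oneArmProb d (criticalProbI d) n) atTop (𝓝 (ν.real E))) :
    ∃ c : ℝ≥0∞, 0 < c ∧ ∀ᵐ ω ∂ν, limsup (fun n => ENNReal.ofReal
        (((((box d n).filter fun z => ω ∈ (openConn (0 : Site d) z : Set (BondConfig (Site d)))).card : ℕ) : ℝ) /
          ((2 * (n : ℝ) + 1) ^ d * oneArmProb d (criticalProbI d) n))) atTop = c := by
  have hd1 : 1 ≤ d := by omega
  have hpc : 0 < ((criticalProbI d : unitInterval) : ℝ) := by rw [coe_criticalProbI]; exact criticalProb_zd_pos d hd1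
  have hπpos : ∀ n, 0 < oneArmProb d (criticalProbI d) n := fun n =>
    (pow_pos hpc _).trans_le (DKT20.pow_le_real_siteToBoundary hd1 (criticalProbI d) _)
  obtain ⟨⟨c, hc⟩, -⟩ := iicMeasure_exists_ae_volume_rates_eq_const_criticalProbI hd hs hϰ hA2 hν
  obtain ⟨lam, hlam, hfat⟩ := iicMeasure_ae_frequently_le_volume hd hs hsL hϰ hA2 hC₀ hTight
  have hio := hfat ν hν
  refine ⟨c, ?_, hc⟩
  -- on a full-measure set: `limsup = c` and `λ s(n) ≤ V_n` infinitely often, so `ofReal λ ≤ c`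
  obtain ⟨ω, hωc, hωio⟩ := (hc.and hio).exists
  have hle : ENNReal.ofReal lam ≤ c := by
    rw [← hωc]
    refine le_limsup_of_frequently_le' (hωio.mono fun n hn => ?_)
    have hs0 : 0 < (2 * (n : ℝ) + 1) ^ d * oneArmProb d (criticalProbI d) n := mul_pos (by positivity) (hπpos n)
    exact ENNReal.ofReal_le_ofReal ((le_div_iff₀ hs0).2 (by simpa only [mul_assoc] using hn))
  exact lt_of_lt_of_le (ENNReal.ofReal_pos.2 hlam) hle

open Classical in
/-- **Kesten's planar IIC, unconditionally**: `limsup_n` and `liminf_n` of `#{z ∈ Λ(n) : 0 ↔ z}/((2n+1)²π_{p_c}(n))` are a.s. constant and the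
`limsup` constant is positive ((A2)□ at aspect `(9,77)` by RSW; planar count tightness `Rsw3.annulusClusterCount_tight_Z2`).
[cite: Kesten1986, Thm. (8)] [cite: Georgii2011, Prop. 7.9] -/
theorem iicMeasure_exists_ae_volume_rates_eq_const_Z2 {ν : Measure (BondConfig (Site 2))} [IsProbabilityMeasure ν]
    (hν : ∀ (F : Finset (Sym2 (Site 2))) (E : Set (BondConfig (Site 2))), MeasurableSet E → DeterminedBy E ↑F →
      Tendsto (fun n : ℕ => (bondPercolation (zdGraph 2) (criticalProbI 2)).real (E ∩ siteToBoundary 2 n) /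
        oneArmProb 2 (criticalProbI 2) n) atTop (𝓝 (ν.real E))) :
    (∃ c : ℝ≥0∞, 0 < c ∧ ∀ᵐ ω ∂ν, limsup (fun n => ENNReal.ofReal
        (((((box 2 n).filter fun z => ω ∈ (openConn (0 : Site 2) z : Set (BondConfig (Site 2)))).card : ℕ) : ℝ) /
          ((2 * (n : ℝ) + 1) ^ 2 * oneArmProb 2 (criticalProbI 2) n))) atTop = c) ∧
    (∃ c : ℝ≥0∞, ∀ᵐ ω ∂ν, liminf (fun n => ENNReal.ofReal
        (((((box 2 n).filter fun z => ω ∈ (openConn (0 : Site 2) z : Set (BondConfig (Site 2)))).card : ℕ) : ℝ) /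
          ((2 * (n : ℝ) + 1) ^ 2 * oneArmProb 2 (criticalProbI 2) n))) atTop = c) := by
  obtain ⟨ϰ, hϰ, hA2⟩ := exists_setToSetQuasiMultAspectAt_two_of_criticalProbI_le
  exact ⟨iicMeasure_exists_ae_limsup_volume_eq_const_pos (d := 2) le_rfl (by norm_num) (by norm_num) hϰ (hA2 _ le_rfl) le_rfl
      Rsw3.annulusClusterCount_tight_Z2 hν,
    (iicMeasure_exists_ae_volume_rates_eq_const_criticalProbI (d := 2) le_rfl (by norm_num) hϰ (hA2 _ le_rfl) hν).2⟩

end Summit.CriticalPhenomena.PercolationContinuityZ3.Theorems.Crossing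

end
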